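import Summits.ValiantsHypothesis.ValiantsHypothesis.Theses.DefinabilityGap
import Literature.Computability.AlgebraicComplexity.BLMW11WeakValiantHypothesis
import Literature.Computability.AlgebraicComplexity.ArithCircuitVars
import Summits.ValiantsHypothesis.ValiantsHypothesis.Theorems.DefinabilityGapAffineRung
import Summits.ValiantsHypothesis.ValiantsHypothesis.Theorems.DefinabilityGapWeakToK1ws
import HarnessLib

/-!
# DefinabilityGap — the glue of the split `KIPlantedHitting ⟸ KIPlantedHittingWs ∧ CollapseToVPws` (kernel)
# (closes the glue item `KIPlantedHittingOfWsSplit`, `stmt-ValiantsHypothesis-23703`)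

decomp-valiant cycle 1, lens 5 (hardness–randomness / PIT axis), gen 2. The writer executed the glued split of the residual
crux K1 = `KIPlantedHitting` (route rev 2, 2026-08-29T20:19Z) into the children `KIPlantedHittingWs` (K1ws, dial position
`VP_ws = VBP`) and `CollapseToVPws` (Bws, collapse propagation one notch down the dial) with the glue item
`KIPlantedHittingOfWsSplit := KIPlantedHittingWs → CollapseToVPws → KIPlantedHitting`. This file PROVES the glue item
against the tree's route decls (`kiPlantedHittingOfWsSplit_holds`).

Proof: by cases on `VP_ℂ = VNP_ℂ`. If `VP ≠ VNP`, K1 holds outright (`vp_eq_vnp_of_not_kiPlantedHitting`, the tree's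
unconditional Kabanets–Impagliazzo engine `kiGenerator_isHittingSetGenerator` on the quadratic-curve design, `per ∉ VP_ℂ` via
`perNotPComputableComplex_iff_holds`). If `VP = VNP` and K1 failed, the failing annihilators form a `VP ⊆ VNP` family
(`exists_annihilator_of_not_k1`); `CollapseToVPws` puts it in `VP_ws`, and `KIPlantedHittingWs` hits it — contradiction. The named
objects `qOf`, `quadDesign`, `kiPer` are the `DefinabilityGapAffineRung` copies (definitionally the inlined terms of the route file).
-/

noncomputable section

open MvPolynomial
open Literature.Computability.AlgebraicComplexity Literature.Computability.MetaComplexity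
open Summit.ValiantsHypothesis.ValiantsHypothesis.Theses.DefinabilityGap
  (KIPlantedHitting KIPlantedHittingWs CollapseToVPws KIPlantedHittingOfWsSplit)
open Summit.ValiantsHypothesis.ValiantsHypothesis.Theorems.DefinabilityGapAffineRung
  (qOf qOf_spec sq_le_qOf quadDesign kiPer quadDesign_isNWDesign)
open Summit.ValiantsHypothesis.ValiantsHypothesis.Theorems.DefinabilityGapWeakToK1ws
  (isPBounded_qOf exists_large_of_not_isPBounded)

namespace Summit.ValiantsHypothesis.ValiantsHypothesis.Theorems.DefinabilityGapWsSplit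

/-! ### The pieces -/



/-- Arithmetic for the assembly: `m^c + c ≤ q^(c+e+1)` once `2 ≤ q` and `m ≤ q`. [folklore] -/
theorem pow_add_le_pow (m q c e : ℕ) (hq : 2 ≤ q) (hmq : m ≤ q) :
    m ^ c + c ≤ q ^ (c + e + 1) := by
  have h1 : m ^ c ≤ q ^ c := Nat.pow_le_pow_left hmq c
  have h2 : c ≤ 2 ^ c := (Nat.lt_two_pow_self).le
  have h3 : 2 ^ c ≤ q ^ c := Nat.pow_le_pow_left hq c
  have h4 : q ^ c + q ^ c ≤ q ^ (c + 1) := by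
    calc q ^ c + q ^ c = q ^ c * 2 := by ring
      _ ≤ q ^ c * q := Nat.mul_le_mul_left _ hq
      _ = q ^ (c + 1) := (pow_succ q c).symm
  have h5 : q ^ (c + 1) ≤ q ^ (c + e + 1) := Nat.pow_le_pow_right (by omega) (by omega)
  omega

/-! ### The KI engine and the annihilator family against the TREE decl `KIPlantedHitting` -/

/-- The KI threshold `T(m,b) = (q^b + q³·((m+1)²(2m+2)) + q^b·(m+1) + m + q + 4)^7` is p-bounded in `m` for every fixed `b`. [folklore] -/
theorem isPBounded_kiThreshold (b : ℕ) : IsPBounded fun m =>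
    (qOf m ^ b + qOf m ^ 3 * ((m + 1) ^ 2 * (2 * m + 2)) + qOf m ^ b * (m + 1) + m + qOf m + 4) ^ 7 := by
  have hq := isPBounded_qOf
  have hm1 : IsPBounded fun m : ℕ => m + 1 := IsPBounded.add_holds IsPBounded.id (IsPBounded.const 1)
  have h2m2 : IsPBounded fun m : ℕ => 2 * m + 2 :=
    IsPBounded.add_holds (IsPBounded.mul_holds (IsPBounded.const 2) IsPBounded.id) (IsPBounded.const 2)
  refine IsPBounded.pow_holds ?_ 7
  refine IsPBounded.add_holds (IsPBounded.add_holds (IsPBounded.add_holds (IsPBounded.add_holds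
    (IsPBounded.add_holds (IsPBounded.pow_holds hq b) (IsPBounded.mul_holds (IsPBounded.pow_holds hq 3)
      (IsPBounded.mul_holds (IsPBounded.pow_holds hm1 2) h2m2))) (IsPBounded.mul_holds
        (IsPBounded.pow_holds hq b) hm1)) IsPBounded.id) hq) (IsPBounded.const 4)

/-- **`¬K1 → VP_ℂ = VNP_ℂ`** against the TREE decl (kernel; contrapositive of `S → K1`, stated with an
EQUATION as conclusion so that no theorem of this file has the item `KIPlantedHitting` as its bare conclusion under
the summit as hypothesis): if `VP ≠ VNP`, the KI-planted permanent map is a hitting-set generator in the sense of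
`KIPlantedHitting` (tree engine `kiGenerator_isHittingSetGenerator`). [cite: KabanetsImpagliazzo2003, Lemma 30] -/
theorem vp_eq_vnp_of_not_kiPlantedHitting (hK1 : ¬ KIPlantedHitting) : VP ℂ = VNP ℂ := by
  by_contra hV
  apply hK1
  intro b m₀
  have hnp : ¬ IsPBounded (fun n => complexity (perPoly (Fin n) ℂ)) :=
    perNotPComputableComplex_iff_holds.2 hV
  obtain ⟨c, hc⟩ := isPBounded_kiThreshold b
  obtain ⟨m, hm, hlt⟩ := exists_large_of_not_isPBounded hnp c m₀
  refine ⟨m, hm, fun D hD hs hΔ => ?_⟩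
  refine kiGenerator_isHittingSetGenerator (quadDesign_isNWDesign m) (perPad ℂ (sq_le_qOf m))
    (s := qOf m ^ b) (Δ := qOf m ^ b) ?_ hs hΔ hD
  rw [complexity_perPad]
  refine lt_of_le_of_lt ?_ ((hc m).trans_lt hlt)
  have hdeg : (perPad ℂ (sq_le_qOf m)).totalDegree ≤ m := totalDegree_perPad_le (sq_le_qOf m)
  have hmax : max 1 (perPad ℂ (sq_le_qOf m)).totalDegree ≤ m + 1 := max_le (by omega) (by omega)
  simp only [Fintype.card_fun, Fintype.card_fin]
  gcongr

/-- **`¬K1 →` a `VNP` annihilator family of `G_m`** against the TREE decl (kernel): the failing annihilators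
(for all large `m`, size and degree `≤ q(m)^b`) form a `VP_ℂ ⊆ VNP_ℂ` family. [this file] -/
theorem exists_annihilator_of_not_k1 (h : ¬ KIPlantedHitting) :
    ∃ Q : ∀ m, MvPolynomial (Fin 3 → Fin (qOf m)) ℂ,
      IsVNPFamily Q ∧ ∃ m₁, ∀ m, m₁ ≤ m → Q m ≠ 0 ∧ bind₁ (kiPer m) (Q m) = 0 := by
  classical
  unfold KIPlantedHitting at h
  push Not at h
  obtain ⟨b, m₀, hann⟩ := h
  choose D hD0 hDs hDΔ hDann using hann
  refine ⟨fun m => if hm : m₀ ≤ m then D m hm else C 0, ?_, m₀, fun m hm => ?_⟩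
  · apply IsVPFamily.isVNPFamily_holds'
    refine ⟨⟨?_, ?_⟩, ?_⟩
    · simp only [Fintype.card_fun, Fintype.card_fin]
      exact IsPBounded.pow_holds isPBounded_qOf 3
    · refine (IsPBounded.pow_holds isPBounded_qOf b).mono fun m => ?_
      dsimp only
      split_ifs with hm
      · exact hDΔ m hm
      · exact (totalDegree_C (0 : ℂ)).le.trans (Nat.zero_le _)
    · refine (IsPBounded.pow_holds isPBounded_qOf b).mono fun m => ?_
      dsimp only
      split_ifs with hm
      · exact hDs m hm
      · exact (complexity_C_holds (0 : ℂ)).le.trans (Nat.zero_le _)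
  · simp only [dif_pos hm]
    exact ⟨hD0 m hm, hDann m hm⟩

/-- **The glue item `KIPlantedHittingOfWsSplit` HOLDS** (kernel): `KIPlantedHittingWs → CollapseToVPws → KIPlantedHitting`
(stated ONLY with the glue item as conclusion, so that no theorem of this file has the parent `KIPlantedHitting` as its bare
conclusion under the children as hypotheses). [this route: DefinabilityGap, glued split of K1 (gen 1, executed 2026-08-29)] -/
theorem kiPlantedHittingOfWsSplit_holds : KIPlantedHittingOfWsSplit := by
  intro h₁ h₃
  by_contra hK1
  have hEq : VP ℂ = VNP ℂ := vp_eq_vnp_of_not_kiPlantedHitting hK1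
  have hsub : ∀ (v : ℕ → ℕ) (f : ∀ n, MvPolynomial (Fin (v n)) ℂ), IsVNPFamily f → IsVPwsFamily f :=
    h₃ hEq
  obtain ⟨Q, hQ, m₁, hann⟩ := exists_annihilator_of_not_k1 hK1
  let e : ∀ n, (Fin 3 → Fin (qOf n)) ≃ Fin (qOf n ^ 3) := fun n => finFunctionFinEquiv
  have hQ' : IsVNPFamily (fun n => renameEquiv ℂ (e n) (Q n)) := (isVNPFamily_renameEquiv_iff e Q).2 hQ
  obtain ⟨c, hc⟩ := hsub (fun n => qOf n ^ 3) _ hQ'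
  obtain ⟨m, hm, hhit⟩ := h₁ (c + 1) m₁
  obtain ⟨hQ0, hQann⟩ := hann m hm
  have hq2 : 2 ≤ qOf m := (qOf_spec m).2.two_le
  have hmq : m ≤ qOf m := (Nat.le_mul_self m).trans (sq_le_qOf m)
  refine hhit (Q m) hQ0 ?_ hQann
  have h1 : wsComplexity (Q m) ≤ m ^ c + c := by
    have := hc m
    simpa only [MvPolynomial.renameEquiv_apply, wsComplexity_rename_equiv] using this
  exact h1.trans (pow_add_le_pow m (qOf m) c 0 hq2 hmq)

end Summit.ValiantsHypothesis.ValiantsHypothesis.Theorems.DefinabilityGapWsSplit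

end
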